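import Mathlib
import HarnessLib.Audit
import Summits.PneNP.PneNP.Theorems.PstarSharedMemberSquare

/-!
# The square of a member with a shared literal (II): `Γ₂` misses `b₂` on the big slice, (M0) fails (ROUND-24, O1; memo g27 §74)

FRONTIER range-avoidance ladder, rung F-N3, ROUND 24 (cell `pnp-ideate`, prover-2 memo `g27/O1-PINNING-g27.md` §74; census node
`PstarLocalGateBudgetAssembly.LocalMenuCriterionBoundGateBudget`; restricted-model proof complexity — nothing here bears on `P` versus `NP`).

Conclusion of `PstarSharedMemberSquare` (setting `Setup I K w₁ w₂ e o σ p q`: member `e = (σ, p)` of `K`, sibling `o = (σ, q)`, privates `p, q`):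

* **`gval_ne_on_sliceBut_shared`** — (T3) on `A`, simple overlaps among the monomials of `Γ₂`, `A₁ = A ∩ {x_σ = 0} ≠ ∅`, and every `Γ₂`-gate
  partner `u ∉ {σ, p, q}` of `σ, p, q` FROZEN on `Ā` or THAWED in `A₁` ⇒ all partners are frozen, the slopes `L_p, L_q, L_σ` vanish on all of
  `Ā = Sol(K ∖ e) ∩ {Γ₁ = b₁}`, and `Γ₂ ≠ b₂` at EVERY point of `Ā` (`x_σ = 1`: flip `p`; `x_σ = 0`: set `p := 1, q := 0`, flip `σ`);
* **`not_terminal_of_shared_member`** — hence (M0) fails at `e`: the pair is not terminal;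
* **`not_terminal_of_untouched_shared`** — in particular `Γ₂` must TOUCH the block of every `N`-member with unpinned literal (some monomial
  through `σ`, `p` or `q`): p3's «the second reader sees every defect», no freeze/thaw hypothesis needed.

With `PstarDirtyMemberSquare.not_terminal_of_dirty_member` and `PstarDeadPatterns` (the side conditions are dead-pattern feasibilities = join
enumerations): on a cycle core every arc with THREE blocks (a dirty chord or an unpinned `N`-literal among them, two further blocks) carries a
member at which (M0) fails — «three-block arcs certify nothing» (p3 memo r24 §14.63), all `k`; hence the folds of a certificate lie in ≤ 2
literal classes per arc (the F₁ bound, g26 §65.4 (ii)).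
-/

set_option linter.dupNamespace false -- `Summit.PneNP.PneNP.…`: summit = sub-problem name (D-0017 single-conjunct layout)

open Finset Literature.Computability.Complexity
open Summit.PneNP.PneNP.Theorems.PstarFibrePolys (bit bit_injective)
open Summit.PneNP.PneNP.Theorems.PstarGapOneAll (gval)
open Summit.PneNP.PneNP.Theorems.PstarCoreBoundTargets (Terminal)
open Summit.PneNP.PneNP.Theorems.PstarMenuLocality (starSum bit_gval_update bit_gval_flip)
open Summit.PneNP.PneNP.Theorems.PstarLiteralPinning (Through InSlice)
open Summit.PneNP.PneNP.Theorems.PstarDirtyMemberSquare (InSliceBut inSlice_iff starSum_update_of_unpaired)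
open Summit.PneNP.PneNP.Theorems.PstarSharedMemberSquare

namespace Summit.PneNP.PneNP.Theorems.PstarSharedMemberKill

variable {n m : ℕ} {I : LocalMap 4 n m} {y : Fin m → Bool} {K : Finset (Fin m)} {w₁ w₂ : Finset (Fin n) × Finset (Fin m) × Bool}
  {e o : Fin m} {σ p q : Fin n}

section Main

variable (H : Setup I K w₁ w₂ e o σ p q)
include H

/-! ### `Γ₂` misses `b₂` on all of `Ā` -/

/-- **`Γ₂` MISSES `b₂` ON ALL OF `Ā`** (hence (M0) fails at `e`).  (T3) on `A`; simple overlaps among the monomials of `Γ₂`; `A₁ ≠ ∅`; every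
`Γ₂`-gate partner `u ∉ {σ, p, q}` of `σ`, `p` or `q` is FROZEN on `Ā` or THAWED in `A₁`. -/
theorem gval_ne_on_sliceBut_shared (hT3 : ∀ z, InSlice I y K w₁ z → gval I w₂.1 w₂.2.1 z ≠ w₂.2.2)
    (hSG : ∀ g ∈ w₂.2.1, ∀ g' ∈ w₂.2.1, g' ≠ g → ¬ ((I.vars g' 2 = I.vars g 2 ∧ I.vars g' 3 = I.vars g 3) ∨
      (I.vars g' 2 = I.vars g 3 ∧ I.vars g' 3 = I.vars g 2)))
    (hA₁ : ∃ z, InSlice I y K w₁ z ∧ z σ = false)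
    (hthaw : ∀ g ∈ w₂.2.1, ∀ u v : Fin n, (v = p ∨ v = q ∨ v = σ) → ((I.vars g 2 = v ∧ I.vars g 3 = u) ∨ (I.vars g 2 = u ∧ I.vars g 3 = v)) →
      u ≠ p → u ≠ q → u ≠ σ →
      (∀ x x' : Fin n → Bool, InSliceBut I y K e w₁ x → InSliceBut I y K e w₁ x' → x u = x' u) ∨
      (∃ z, (InSlice I y K w₁ z ∧ z σ = false) ∧ InSlice I y K w₁ (Function.update z u (!z u))))
    {x : Fin n → Bool} (hx : InSliceBut I y K e w₁ x) : gval I w₂.1 w₂.2.1 x ≠ w₂.2.2 := by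
  have hd := distinct H
  obtain ⟨z₁, hz₁, hz₁σ⟩ := hA₁
  have hz₁b := ((inSlice_iff H.he).1 hz₁).1
  -- uniqueness of a gate with a given pair, from simple overlaps
  have huniq : ∀ g ∈ w₂.2.1, ∀ u v, ((I.vars g 2 = v ∧ I.vars g 3 = u) ∨ (I.vars g 2 = u ∧ I.vars g 3 = v)) →
      ∀ g' ∈ w₂.2.1, g' ≠ g → ¬ ((I.vars g' 2 = v ∧ I.vars g' 3 = u) ∨ (I.vars g' 2 = u ∧ I.vars g' 3 = v)) := by
    intro g hg u v hgs g' hg' hne' h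
    apply hSG g hg g' hg' hne'
    rcases hgs with ⟨h2, h3⟩ | ⟨h2, h3⟩ <;> rcases h with ⟨h2', h3'⟩ | ⟨h2', h3'⟩
    · exact Or.inl ⟨h2'.trans h2.symm, h3'.trans h3.symm⟩
    · exact Or.inr ⟨h2'.trans h3.symm, h3'.trans h2.symm⟩
    · exact Or.inr ⟨h2'.trans h3.symm, h3'.trans h2.symm⟩
    · exact Or.inl ⟨h2'.trans h2.symm, h3'.trans h3.symm⟩
  -- every gate partner of `v ∈ {p, q, σ}` is frozen: it has the same value at every point of `Ā` as at `z₁`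
  have hfrozen : ∀ x' : Fin n → Bool, InSliceBut I y K e w₁ x' → ∀ g ∈ w₂.2.1, ∀ u v : Fin n, (v = p ∨ v = q ∨ v = σ) →
      ((I.vars g 2 = v ∧ I.vars g 3 = u) ∨ (I.vars g 2 = u ∧ I.vars g 3 = v)) → x' u = z₁ u := by
    intro x' hx' g hg u v hv hgs
    have huv : u ≠ v := by
      rcases hgs with ⟨h2, h3⟩ | ⟨h2, h3⟩
      · exact fun huv => absurd (h2.trans (h3.trans huv).symm) fun h => absurd (H.pure.2 g h) (by decide)
      · exact fun huv => absurd ((h2.trans huv).trans h3.symm) fun h => absurd (H.pure.2 g h) (by decide)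
    have huσ : u ≠ σ := by
      rintro rfl
      rcases hv with rfl | rfl | rfl
      · exact (H.hG₂ g hg).1 (hgs.elim (fun h => Or.inr h) fun h => Or.inl h)
      · exact (H.hG₂ g hg).2 (hgs.elim (fun h => Or.inr h) fun h => Or.inl h)
      · exact huv rfl
    have hup : u ≠ p := by
      rintro rfl
      rcases hv with rfl | rfl | rfl
      · exact huv rfl
      · -- a gate `{q, p}`: but `p` is thawed in `A₁`
        exact not_thawed_q H hT3 hg hgs (huniq g hg _ _ hgs) hd.1.symm hz₁ hz₁σ (inSlice_update_p H hz₁σ hz₁ _)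
      · exact (H.hG₂ g hg).1 hgs
    have huq : u ≠ q := by
      rintro rfl
      rcases hv with rfl | rfl | rfl
      · exact not_thawed_p H hT3 hg hgs (huniq g hg _ _ hgs) hd.2.1.symm hz₁ hz₁σ (inSlice_update_q H hz₁σ hz₁ _)
      · exact huv rfl
      · exact (H.hG₂ g hg).2 hgs
    rcases hthaw g hg u v hv hgs hup huq huσ with hfr | ⟨z, ⟨hz, hzσ⟩, hz'⟩
    · exact hfr x' z₁ hx' hz₁b
    · exfalso
      rcases hv with rfl | rfl | rfl
      · exact not_thawed_p H hT3 hg hgs (huniq g hg _ _ hgs) huσ hz hzσ hz'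
      · exact not_thawed_q H hT3 hg hgs (huniq g hg _ _ hgs) huσ hz hzσ hz'
      · exact not_thawed_sigma H hT3 hg hgs (huniq g hg _ _ hgs) hup huq huσ hz hzσ hz'
  -- hence each slope is the same at every point of `Ā` as at `z₁`
  have hstar : ∀ v, (v = p ∨ v = q ∨ v = σ) → ∀ x' : Fin n → Bool, InSliceBut I y K e w₁ x' →
      starSum I w₂.2.1 v x' = starSum I w₂.2.1 v z₁ := by
    intro v hv x' hx'
    unfold PstarMenuLocality.starSum
    refine sum_congr rfl fun g hg => ?_
    by_cases h2 : I.vars g 2 = v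
    · have h3 : I.vars g 3 ≠ v := fun h => absurd (h2.trans h.symm) fun h' => absurd (H.pure.2 g h') (by decide)
      rw [if_pos h2, if_pos h2, if_neg h3, if_neg h3, hfrozen x' hx' g hg (I.vars g 3) v hv (Or.inl ⟨h2, rfl⟩)]
    · by_cases h3 : I.vars g 3 = v
      · rw [if_neg h2, if_neg h2, if_pos h3, if_pos h3, hfrozen x' hx' g hg (I.vars g 2) v hv (Or.inr ⟨rfl, h3⟩)]
      · rw [if_neg h2, if_neg h2, if_neg h3, if_neg h3]
  -- … and the slopes at `z₁` (for `σ`: at `z₁[p, q := 0]`) vanish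
  have hLp : ∀ x' : Fin n → Bool, InSliceBut I y K e w₁ x' → (if p ∈ w₂.1 then (1 : ZMod 2) else 0) + starSum I w₂.2.1 p x' = 0 :=
    fun x' hx' => by rw [hstar p (Or.inl rfl) x' hx']; exact slope_p_zero H hT3 hz₁ hz₁σ
  have hLq : ∀ x' : Fin n → Bool, InSliceBut I y K e w₁ x' → (if q ∈ w₂.1 then (1 : ZMod 2) else 0) + starSum I w₂.2.1 q x' = 0 :=
    fun x' hx' => by rw [hstar q (Or.inr (Or.inl rfl)) x' hx']; exact slope_q_zero H hT3 hz₁ hz₁σ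
  have hLσ : ∀ x' : Fin n → Bool, InSliceBut I y K e w₁ x' → (if σ ∈ w₂.1 then (1 : ZMod 2) else 0) + starSum I w₂.2.1 σ x' = 0 := by
    intro x' hx'
    set z₀ := Function.update (Function.update z₁ p false) q false with hz₀
    have hz₁pσ : Function.update z₁ p false σ = false := by rw [Function.update_of_ne hd.1]; exact hz₁σ
    have hz₀A : InSlice I y K w₁ z₀ := inSlice_update_q H hz₁pσ (inSlice_update_p H hz₁σ hz₁ false) false
    have hp0 : z₀ p = false := by rw [hz₀, Function.update_of_ne hd.2.2, Function.update_self]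
    have hq0 : z₀ q = false := by rw [hz₀, Function.update_self]
    have h0 := slope_sigma_zero H hT3 hz₀A hp0 hq0
    -- no gate pairs `σ` with `p` or `q`, so the partner sum of `σ` ignores the normalisation
    have hunp : ∀ w, (w = p ∨ w = q) → ∀ zz : Fin n → Bool, ∀ b, starSum I w₂.2.1 σ (Function.update zz w b) = starSum I w₂.2.1 σ zz := by
      intro w hw zz b
      refine starSum_update_of_unpaired _ zz b fun g hg => ⟨fun h2 h3 => ?_, fun h3 h2 => ?_⟩
      · rcases hw with rfl | rfl
        · exact (H.hG₂ g hg).1 (Or.inl ⟨h2, h3⟩)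
        · exact (H.hG₂ g hg).2 (Or.inl ⟨h2, h3⟩)
      · rcases hw with rfl | rfl
        · exact (H.hG₂ g hg).1 (Or.inr ⟨h2, h3⟩)
        · exact (H.hG₂ g hg).2 (Or.inr ⟨h2, h3⟩)
    rw [hz₀, hunp q (Or.inr rfl), hunp p (Or.inl rfl)] at h0
    rw [hstar σ (Or.inr (Or.inr rfl)) x' hx']
    exact h0
  -- ENDGAME.  `κ`-valued on `A`; propagate to `x` along free moves.
  have hneb : ∀ a b : Bool, a ≠ b → (!a) = b := by decide
  by_cases hxσ : x σ = true
  · -- flip `p`: one of the two points solves `e`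
    set x' := Function.update x p (!x p) with hx'd
    have hx' : InSliceBut I y K e w₁ x' := sliceBut_update_p H hx _
    have hΓ : gval I w₂.1 w₂.2.1 x' = gval I w₂.1 w₂.2.1 x := by
      apply bit_injective
      rw [hx'd, bit_gval_flip I H.pure, hLp x hx, add_zero]
    have hev : I.eval x' e = !I.eval x e := by
      rw [eval_e H, eval_e H, hx'd, Function.update_of_ne (H.hX e H.he).2.2.1, Function.update_of_ne (H.hX e H.he).2.2.2.1,
        Function.update_of_ne hd.1, Function.update_self, hxσ, Bool.true_and, Bool.true_and, Bool.xor_not]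
    by_cases hA : I.eval x e = y e
    · exact hT3 x ((inSlice_iff H.he).2 ⟨hx, hA⟩)
    · rw [← hΓ]
      exact hT3 x' ((inSlice_iff H.he).2 ⟨hx', by rw [hev]; exact hneb _ _ hA⟩)
  · rw [Bool.not_eq_true] at hxσ
    -- set `p := 1`, `q := 0` (free), then flip `σ` if needed
    set x₁ := Function.update x p true with hx₁d
    have hx₁ : InSliceBut I y K e w₁ x₁ := sliceBut_update_p H hx _
    have hx₁σ : x₁ σ = false := by rw [hx₁d, Function.update_of_ne hd.1]; exact hxσ
    have hΓ₁ : gval I w₂.1 w₂.2.1 x₁ = gval I w₂.1 w₂.2.1 x := by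
      apply bit_injective
      rw [hx₁d, bit_gval_update I H.pure, hLp x hx, mul_zero, add_zero]
    set x₂ := Function.update x₁ q false with hx₂d
    have hx₂ : InSliceBut I y K e w₁ x₂ := sliceBut_update_q H hx₁σ hx₁ _
    have hx₂σ : x₂ σ = false := by rw [hx₂d, Function.update_of_ne hd.2.1]; exact hx₁σ
    have hx₂p : x₂ p = true := by rw [hx₂d, Function.update_of_ne hd.2.2, hx₁d, Function.update_self]
    have hx₂q : x₂ q = false := by rw [hx₂d, Function.update_self]
    have hΓ₂ : gval I w₂.1 w₂.2.1 x₂ = gval I w₂.1 w₂.2.1 x₁ := by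
      apply bit_injective
      rw [hx₂d, bit_gval_update I H.pure, hLq x₁ hx₁, mul_zero, add_zero]
    by_cases hA : I.eval x₂ e = y e
    · rw [← hΓ₁, ← hΓ₂]
      exact hT3 x₂ ((inSlice_iff H.he).2 ⟨hx₂, hA⟩)
    · set x₃ := Function.update x₂ σ true with hx₃d
      have hx₃ : InSliceBut I y K e w₁ x₃ := sliceBut_update_sigma H hx₂q hx₂ _
      have hΓ₃ : gval I w₂.1 w₂.2.1 x₃ = gval I w₂.1 w₂.2.1 x₂ := by
        apply bit_injective
        rw [hx₃d, bit_gval_update I H.pure, hLσ x₂ hx₂, mul_zero, add_zero]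
      have hev : I.eval x₃ e = !I.eval x₂ e := by
        rw [eval_e H, eval_e H, hx₃d, Function.update_of_ne (H.hX e H.he).1, Function.update_of_ne (H.hX e H.he).2.1,
          Function.update_self, Function.update_of_ne hd.1.symm, hx₂p, hx₂σ, Bool.true_and, Bool.false_and, Bool.xor_false,
          Bool.xor_true]
      rw [← hΓ₁, ← hΓ₂, ← hΓ₃]
      exact hT3 x₃ ((inSlice_iff H.he).2 ⟨hx₃, by rw [hev]; exact hneb _ _ hA⟩)

/-- **A SHARED-LITERAL MEMBER WITH FROZEN-OR-THAWED GATE PARTNERS KILLS THE CERTIFICATE**: under the hypotheses of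
`gval_ne_on_sliceBut_shared` the pair `(K; Γ₁, Γ₂)` is not terminal ((M0) at `e` fails). -/
theorem not_terminal_of_shared_member {r : ℕ} (hSG : ∀ g ∈ w₂.2.1, ∀ g' ∈ w₂.2.1, g' ≠ g →
      ¬ ((I.vars g' 2 = I.vars g 2 ∧ I.vars g' 3 = I.vars g 3) ∨ (I.vars g' 2 = I.vars g 3 ∧ I.vars g' 3 = I.vars g 2)))
    (hA₁ : ∃ z, InSlice I y K w₁ z ∧ z σ = false)
    (hthaw : ∀ g ∈ w₂.2.1, ∀ u v : Fin n, (v = p ∨ v = q ∨ v = σ) → ((I.vars g 2 = v ∧ I.vars g 3 = u) ∨ (I.vars g 2 = u ∧ I.vars g 3 = v)) →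
      u ≠ p → u ≠ q → u ≠ σ →
      (∀ x x' : Fin n → Bool, InSliceBut I y K e w₁ x → InSliceBut I y K e w₁ x' → x u = x' u) ∨
      (∃ z, (InSlice I y K w₁ z ∧ z σ = false) ∧ InSlice I y K w₁ (Function.update z u (!z u)))) :
    ¬ Terminal I r y K w₁ w₂ := by
  intro ht
  obtain ⟨-, -, -, -, -, -, hT3, hM0⟩ := ht
  have hT3' : ∀ z, InSlice I y K w₁ z → gval I w₂.1 w₂.2.1 z ≠ w₂.2.2 := fun z hz h => hT3 ⟨z, hz.1, hz.2, h⟩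
  obtain ⟨x, hxK, hx₁, hx₂⟩ := hM0 e H.he
  exact gval_ne_on_sliceBut_shared H hT3' hSG hA₁ hthaw ⟨fun j hj hje => hxK j (mem_erase.2 ⟨hje, hj⟩), hx₁⟩ hx₂

/-- **`Γ₂` MUST TOUCH `e`'s block.**  If no monomial of `Γ₂` passes through `σ`, `p` or `q` and `A₁ ≠ ∅` (`σ` unpinned), the pair is not terminal —
p3's «the second reader sees every defect», for an `N`-member with a sibling. -/
theorem not_terminal_of_untouched_shared {r : ℕ} (huntouched : ∀ g ∈ w₂.2.1, ¬ Through I σ g ∧ ¬ Through I p g ∧ ¬ Through I q g)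
    (hA₁ : ∃ z, InSlice I y K w₁ z ∧ z σ = false) : ¬ Terminal I r y K w₁ w₂ := by
  intro ht
  obtain ⟨-, -, -, -, -, -, hT3, hM0⟩ := ht
  have hT3' : ∀ z, InSlice I y K w₁ z → gval I w₂.1 w₂.2.1 z ≠ w₂.2.2 := fun z hz h => hT3 ⟨z, hz.1, hz.2, h⟩
  obtain ⟨x, hxK, hx₁, hx₂⟩ := hM0 e H.he
  have hx : InSliceBut I y K e w₁ x := ⟨fun j hj hje => hxK j (mem_erase.2 ⟨hje, hj⟩), hx₁⟩
  -- with no gate through `σ, p, q` all three slopes are the constants `[v ∈ C₂]`, which vanish at an idle point; rerun the endgame directly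
  have hd := distinct H
  obtain ⟨z₁, hz₁, hz₁σ⟩ := hA₁
  have hstar0 : ∀ v, (v = p ∨ v = q ∨ v = σ) → ∀ zz : Fin n → Bool, starSum I w₂.2.1 v zz = 0 := by
    intro v hv zz
    unfold PstarMenuLocality.starSum
    refine sum_eq_zero fun g hg => ?_
    have hng : ¬ Through I v g := by
      rcases hv with rfl | rfl | rfl
      exacts [(huntouched g hg).2.1, (huntouched g hg).2.2, (huntouched g hg).1]
    rw [if_neg (fun h => hng (Or.inl h)), if_neg (fun h => hng (Or.inr h)), add_zero]
  have hLp : (if p ∈ w₂.1 then (1 : ZMod 2) else 0) = 0 := by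
    have := slope_p_zero H hT3' hz₁ hz₁σ; rwa [hstar0 p (Or.inl rfl), add_zero] at this
  have hLq : (if q ∈ w₂.1 then (1 : ZMod 2) else 0) = 0 := by
    have := slope_q_zero H hT3' hz₁ hz₁σ; rwa [hstar0 q (Or.inr (Or.inl rfl)), add_zero] at this
  have hLσ : (if σ ∈ w₂.1 then (1 : ZMod 2) else 0) = 0 := by
    have hz₁pσ : Function.update z₁ p false σ = false := by rw [Function.update_of_ne hd.1]; exact hz₁σ
    have hz₀A := inSlice_update_q H hz₁pσ (inSlice_update_p H hz₁σ hz₁ false) false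
    have := slope_sigma_zero H hT3' hz₀A (by rw [Function.update_of_ne hd.2.2, Function.update_self]) (by rw [Function.update_self])
    rwa [hstar0 σ (Or.inr (Or.inr rfl)), add_zero] at this
  have hneb : ∀ a b : Bool, a ≠ b → (!a) = b := by decide
  apply (show gval I w₂.1 w₂.2.1 x ≠ w₂.2.2 from ?_) hx₂
  by_cases hxσ : x σ = true
  · set x' := Function.update x p (!x p) with hx'd
    have hx' : InSliceBut I y K e w₁ x' := sliceBut_update_p H hx _
    have hΓ : gval I w₂.1 w₂.2.1 x' = gval I w₂.1 w₂.2.1 x := by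
      apply bit_injective
      rw [hx'd, bit_gval_flip I H.pure, hLp, hstar0 p (Or.inl rfl), add_zero, add_zero]
    have hev : I.eval x' e = !I.eval x e := by
      rw [eval_e H, eval_e H, hx'd, Function.update_of_ne (H.hX e H.he).2.2.1, Function.update_of_ne (H.hX e H.he).2.2.2.1,
        Function.update_of_ne hd.1, Function.update_self, hxσ, Bool.true_and, Bool.true_and, Bool.xor_not]
    by_cases hA : I.eval x e = y e
    · exact hT3' x ((inSlice_iff H.he).2 ⟨hx, hA⟩)
    · rw [← hΓ]
      exact hT3' x' ((inSlice_iff H.he).2 ⟨hx', by rw [hev]; exact hneb _ _ hA⟩)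
  · rw [Bool.not_eq_true] at hxσ
    set x₁ := Function.update x p true with hx₁d
    have hx₁ : InSliceBut I y K e w₁ x₁ := sliceBut_update_p H hx _
    have hx₁σ : x₁ σ = false := by rw [hx₁d, Function.update_of_ne hd.1]; exact hxσ
    have hΓ₁ : gval I w₂.1 w₂.2.1 x₁ = gval I w₂.1 w₂.2.1 x := by
      apply bit_injective
      rw [hx₁d, bit_gval_update I H.pure, hLp, hstar0 p (Or.inl rfl), add_zero, mul_zero, add_zero]
    set x₂ := Function.update x₁ q false with hx₂d
    have hx₂ : InSliceBut I y K e w₁ x₂ := sliceBut_update_q H hx₁σ hx₁ _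
    have hx₂σ : x₂ σ = false := by rw [hx₂d, Function.update_of_ne hd.2.1]; exact hx₁σ
    have hx₂p : x₂ p = true := by rw [hx₂d, Function.update_of_ne hd.2.2, hx₁d, Function.update_self]
    have hx₂q : x₂ q = false := by rw [hx₂d, Function.update_self]
    have hΓ₂ : gval I w₂.1 w₂.2.1 x₂ = gval I w₂.1 w₂.2.1 x₁ := by
      apply bit_injective
      rw [hx₂d, bit_gval_update I H.pure, hLq, hstar0 q (Or.inr (Or.inl rfl)), add_zero, mul_zero, add_zero]
    by_cases hA : I.eval x₂ e = y e
    · rw [← hΓ₁, ← hΓ₂]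
      exact hT3' x₂ ((inSlice_iff H.he).2 ⟨hx₂, hA⟩)
    · set x₃ := Function.update x₂ σ true with hx₃d
      have hx₃ : InSliceBut I y K e w₁ x₃ := sliceBut_update_sigma H hx₂q hx₂ _
      have hΓ₃ : gval I w₂.1 w₂.2.1 x₃ = gval I w₂.1 w₂.2.1 x₂ := by
        apply bit_injective
        rw [hx₃d, bit_gval_update I H.pure, hLσ, hstar0 σ (Or.inr (Or.inr rfl)), add_zero, mul_zero, add_zero]
      have hev : I.eval x₃ e = !I.eval x₂ e := by
        rw [eval_e H, eval_e H, hx₃d, Function.update_of_ne (H.hX e H.he).1, Function.update_of_ne (H.hX e H.he).2.1,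
          Function.update_self, Function.update_of_ne hd.1.symm, hx₂p, hx₂σ, Bool.true_and, Bool.false_and, Bool.xor_false,
          Bool.xor_true]
      rw [← hΓ₁, ← hΓ₂, ← hΓ₃]
      exact hT3' x₃ ((inSlice_iff H.he).2 ⟨hx₃, by rw [hev]; exact hneb _ _ hA⟩)

end Main

end Summit.PneNP.PneNP.Theorems.PstarSharedMemberKill
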